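import Literature.AnabelianGeometry.SemiGraphs.TemperedFibreProductCompletion
import Literature.AnabelianGeometry.SemiGraphs.TemperedFreeTwoSlim
import Literature.AnabelianGeometry.SemiGraphs.TemperedCurves
import Literature.AnabelianGeometry.SemiGraphs.TemperedDecompositionCompact
import Literature.AnabelianGeometry.EtaleTheta.SettingFreeProfiniteTransport
import Literature.IUT.HodgeTheaters.ZHatIntegersInjective
import Literature.GroupTheory.CombinatorialGroupTheory.FreeGroupHopfian
import Mathlib.FieldTheory.IsAlgClosed.AlgebraicClosure
import HarnessLib

/-!
# A kernel inhabitant of the L3 interface `OncePuncturedTemperedGroup` ([EtTh] §1 / [SemiAnbd] Ex. 3.10)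
# — non-vacuity witness with GENUINE geometric part and DEGENERATE arithmetic part

Mochizuki, *The étale theta function …*, Publ. RIMS **45** (2009) [EtTh], §1, PRIMS pp. 237–239
("`Π^tp_X`", "the natural surjection `Π^tp_X ↠ Z`", "`Π_X := (Π^tp_X)^∧`", "`Δ_X` is a profinite free group
on 2 generators") and *Semi-graphs of anabelioids*, Publ. RIMS **42** (2006) [SemiAnbd], Ex. 3.10 pp. 43–45
("`Π` [is] temp-slim"). abc-iut cell, wave-5 prover seat abc-iut-w5-d218 (gen 2); VACUITY LANE. The L3
interface `OncePuncturedTemperedGroup K` (`TemperedCurves.lean`, abc-iut-L3-t2; 15 consumer files) had NO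
kernel inhabitant — `TemperedCurvesWitness.lean` (abc-iut-c312-4) inhabits only the weaker
`TemperedArithmeticGroup` and names this as open: "needs a provably SLIM non-compact tempered group
surjecting onto `ℤ`". This file supplies one:
* base field `K` ALGEBRAICALLY CLOSED — so `G_K = 1` (`K → K̄` is onto):
  the ARITHMETIC side is DEGENERATE (honest label; the intended case is `K/ℚ_p` finite);
* `Π := Γ = F̂₂ ×_{Ẑ} ℤ ≤ F̂₂ × ℤ` (parts A–C: `TemperedFibreProduct*.lean`, `TemperedFreeTwoSlim.lean`):
  GENUINELY tempered (pro-discrete, complete), SLIM, second countable, non-compact, with the discrete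
  surjection `pr₂ : Π ↠ ℤ` of open profinite kernel `Ker ê × 0` (the "`Π^tp_Y`");
* `Π̂ := F̂₂`, `toHat := pr₁` — an injective `IsProfiniteCompletion`; `Δ̂ = F̂₂` is profinite free on two
  generators (`SettingFreeProfiniteWitness`, abc-iut-w5-d218 gen 0, transported);
* cusp data DEGENERATE: the family `{⊥}` (closed, in `Ker pr₂`, conjugation-stable, onto `G_K = 1`).
Auxiliary classical facts proved here: open subgroups of slim groups are slim; `ℤ → Ẑ` separates
finite-index subgroups (`mem_of_toCompletion_mem_closure`); `F̂₂` is second countable (finitely many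
subgroups of each index in `F₂`, tree `FreeGroup.finite_setOf_index_eq`). HONEST FRAMING: a model is
CONSISTENCY EVIDENCE for the axiom package only (consistency ≠ faithfulness); nothing of [EtTh]/[SemiAnbd] is
asserted; no side is taken on [IUTchIII] Cor. 3.12 or any disputed claim.
-/

noncomputable section

open Topology TopologicalSpace Filter Set Function CategoryTheory
open Literature.IUT.HodgeTheaters (profiniteCompletion toCompletion toCompletion_int_injective)
open Literature.AlgebraicGeometry.Frobenioids (IsSlimGroup)
open Literature.GroupTheory.CombinatorialGroupTheory
open Literature.AnabelianGeometry.EtaleTheta.DiscreteNormalizers (continuous_val)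

universe u

namespace Literature.AnabelianGeometry.SemiGraphs

/-! ### Auxiliary classical facts -/

/-- **Open subgroups of slim groups are slim**: an open subgroup of an open subgroup `H` is open in `G`,
so its centraliser in `G`, a fortiori in `H`, is trivial ([SemiAnbd] §0 / Ex. 3.10 "temp-slim").
[cite: MochizukiSemiAnbd2006, Ex 3.10 p.45] -/
theorem isSlimGroup_subgroup_of_isOpen {G : Type u} [Group G] [TopologicalSpace G] [ContinuousMul G]
    (hG : IsSlimGroup G) (H : Subgroup G) (hH : IsOpen (H : Set G)) : IsSlimGroup H := by
  refine ⟨fun U hU => ?_⟩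
  -- `U` as a subgroup of `G` is open
  have hUo : IsOpen ((U.map H.subtype : Subgroup G) : Set G) := by
    have : ((U.map H.subtype : Subgroup G) : Set G) = Subtype.val '' (U : Set H) := by
      ext x; simp
    rw [this]
    exact hH.isOpenMap_subtype_val _ hU
  have hc := hG.centralizer_eq_bot _ hUo
  refine (Subgroup.eq_bot_iff_forall _).mpr fun c hc' => ?_
  have hcG : (c : G) ∈ Subgroup.centralizer ((U.map H.subtype : Subgroup G) : Set G) := by
    rw [Subgroup.mem_centralizer_iff]
    rintro _ ⟨u, hu, rfl⟩
    have := Subgroup.mem_centralizer_iff.mp hc' u hu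
    exact congrArg Subtype.val this
  rw [hc] at hcG
  exact Subtype.ext (Subgroup.mem_bot.mp hcG)

/-- **`ℤ → Ẑ` separates finite-index subgroups**: if `ι k` lies in the closure of `ι(A)` for a subgroup
`A ≤ ℤ` of finite index, then `k ∈ A` (the component of `Ẑ` at the level `A` is continuous into the
discrete group `ℤ/A` and kills `ι(A)`). [cite: MochizukiSemiAnbd2006, §6 p.69] -/
theorem mem_of_toCompletion_mem_closure (A : Subgroup (Multiplicative ℤ)) [A.FiniteIndex]
    (k : Multiplicative ℤ)
    (hk : toCompletion (Multiplicative ℤ) k ∈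
      closure (toCompletion (Multiplicative ℤ) '' (A : Set (Multiplicative ℤ)))) : k ∈ A := by
  let N : FiniteIndexNormalSubgroup (Multiplicative ℤ) := { toSubgroup := A }
  haveI : DiscreteTopology ((ProfiniteGrp.ProfiniteCompletion.diagram
      (GrpCat.of (Multiplicative ℤ))).obj N) := ⟨rfl⟩
  -- the closed set `{x | x.val N = 1}` contains `ι(A)`
  have hclosed : IsClosed ((fun x : profiniteCompletion (Multiplicative ℤ) => x.val N) ⁻¹' {y | y = 1}) :=
    (isClosed_discrete _).preimage (continuous_val N)
  have hsub : toCompletion (Multiplicative ℤ) '' (A : Set (Multiplicative ℤ)) ⊆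
      ((fun x : profiniteCompletion (Multiplicative ℤ) => x.val N) ⁻¹' {y | y = 1}) := by
    rintro _ ⟨g, hg, rfl⟩
    change ((QuotientGroup.mk g : Multiplicative ℤ ⧸ N.toSubgroup)) = 1
    exact (QuotientGroup.eq_one_iff g).mpr hg
  have h1 : (toCompletion (Multiplicative ℤ) k).val N = 1 := closure_minimal hsub hclosed hk
  change ((QuotientGroup.mk k : Multiplicative ℤ ⧸ N.toSubgroup)) = 1 at h1
  exact (QuotientGroup.eq_one_iff k).mp h1

/-- A free group of finite rank has countably many normal subgroups of finite index (finitely many of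
each index, tree `FreeGroup.finite_setOf_index_eq`). [cite: LyndonSchupp2001, Ch. IV Thm. 4.10] -/
theorem countable_finiteIndexNormalSubgroup_freeGroup (α : Type) [Finite α] :
    Countable (FiniteIndexNormalSubgroup (FreeGroup α)) := by
  have hS : ({H : Subgroup (FreeGroup α) | H.index ≠ 0} : Set _).Countable := by
    have : ({H : Subgroup (FreeGroup α) | H.index ≠ 0} : Set _) ⊆
        ⋃ n : ℕ, {H : Subgroup (FreeGroup α) | H.index = n + 1} := by
      intro H hH
      obtain ⟨n, hn⟩ := Nat.exists_eq_succ_of_ne_zero hH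
      exact Set.mem_iUnion.mpr ⟨n, hn⟩
    exact (Set.countable_iUnion fun n =>
      (FreeGroup.finite_setOf_index_eq (Nat.succ_ne_zero n)).countable).mono this
  haveI := hS.to_subtype
  let f : FiniteIndexNormalSubgroup (FreeGroup α) → {H : Subgroup (FreeGroup α) | H.index ≠ 0} :=
    fun N => ⟨N.toSubgroup, N.isFiniteIndex'.index_ne_zero⟩
  refine Function.Injective.countable (f := f) fun N M h => ?_
  exact FiniteIndexNormalSubgroup.toSubgroup_injective (congrArg Subtype.val h)

/-- **`F̂₂` is second countable** (indeed `F̂_α` for `α` finite): it is a subspace of the countable product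
of the finite discrete quotients `F/N` ([IUTchI] Rmk. 2.5.3 (i) (T1) "Galois-countable").
[cite: MochizukiSemiAnbd2006, §6 p.69] -/
theorem secondCountableTopology_profiniteCompletion_freeGroup (α : Type) [Finite α] :
    SecondCountableTopology (profiniteCompletion (FreeGroup α)) := by
  haveI := countable_finiteIndexNormalSubgroup_freeGroup α
  haveI : ∀ N : FiniteIndexNormalSubgroup (FreeGroup α),
      DiscreteTopology ((ProfiniteGrp.ProfiniteCompletion.diagram (GrpCat.of (FreeGroup α))).obj N) :=
    fun N => ⟨rfl⟩
  haveI : ∀ N : FiniteIndexNormalSubgroup (FreeGroup α),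
      Countable ((ProfiniteGrp.ProfiniteCompletion.diagram (GrpCat.of (FreeGroup α))).obj N) :=
    fun N => by
      haveI : N.toSubgroup.FiniteIndex := N.isFiniteIndex'
      exact (inferInstance : Countable (FreeGroup α ⧸ N.toSubgroup))
  haveI : ∀ N : FiniteIndexNormalSubgroup (FreeGroup α),
      SecondCountableTopology
        ((ProfiniteGrp.ProfiniteCompletion.diagram (GrpCat.of (FreeGroup α))).obj N) :=
    fun N => DiscreteTopology.secondCountableTopology_of_countable
  exact Topology.IsInducing.subtypeVal.secondCountableTopology

/-- The universal property of the profinite completion, pointwise: the continuous extension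
`lift f : F̂ → P` of `f : F → P` (`P` profinite) agrees with `f` on `η(F)`.
[cite: MochizukiSemiAnbd2006, §6 p.69] -/
theorem lift_hom_toCompletion {F : Type} [Group F] (P : ProfiniteGrp.{0}) (f : F →* P) (g : F) :
    (ProfiniteGrp.ProfiniteCompletion.lift (GrpCat.ofHom f)).hom (toCompletion F g) = f g := by
  have h := ConcreteCategory.congr_hom
    (ProfiniteGrp.ProfiniteCompletion.lift_eta (G := GrpCat.of F) (GrpCat.ofHom f)) g
  exact h

/-! ### The inhabitant -/

/-- **Kernel inhabitant of `OncePuncturedTemperedGroup K` for `K` algebraically closed** — GEOMETRIC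
model, ARITHMETICALLY DEGENERATE (`G_K = 1`; cusp family `{⊥}`): `Π := F̂₂ ×_{Ẑ} ℤ` (tempered, slim,
second countable), `Π ↠ ℤ` the second projection (open kernel), `Π̂ := F̂₂` with `toHat := pr₁` an
injective `IsProfiniteCompletion`, `augHat` trivial with kernel `F̂₂ =` the closure of the image of
`Δ = Π`, profinite free on `2` generators. CONSISTENCY EVIDENCE for the axiom package of the L3
interface ([EtTh] §1 pp. 237–239 / [SemiAnbd] Ex. 3.10 as typed in `TemperedCurves.lean`); it is not the
tempered fundamental group of a curve and asserts nothing of print.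
[cite: MochizukiEtTh2009, §1 pp.237-239] -/
theorem OncePuncturedTemperedGroup.nonempty_model_of_isAlgClosed (K : Type) [Field K] [IsAlgClosed K] :
    Nonempty (OncePuncturedTemperedGroup K) := by
  classical
  -- `G_K = 1` for `K` algebraically closed (`K → K̄` is onto)
  haveI : Subsingleton (Field.absoluteGaloisGroup K) := by
    refine ⟨fun σ τ => AlgEquiv.ext fun x => ?_⟩
    obtain ⟨k, rfl⟩ :=
      (IsAlgClosed.algebraMap_bijective_of_isIntegral (k := K) (K := AlgebraicClosure K)).2 x
    rw [AlgEquiv.commutes, AlgEquiv.commutes]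
  -- the profinite data
  let F := FreeGroup (Fin 2)
  let P : ProfiniteGrp.{0} := profiniteCompletion (FreeGroup (Fin 2))
  let Zh : ProfiniteGrp.{0} := profiniteCompletion (Multiplicative ℤ)
  let η : FreeGroup (Fin 2) →* P := toCompletion (FreeGroup (Fin 2))
  let ι : Multiplicative ℤ →* Zh := toCompletion (Multiplicative ℤ)
  let a : FreeGroup (Fin 2) := FreeGroup.of 0
  let b : FreeGroup (Fin 2) := FreeGroup.of 1
  -- exponent sums
  let σa : FreeGroup (Fin 2) →* Multiplicative ℤ :=
    FreeGroup.lift fun j => if j = (0 : Fin 2) then Multiplicative.ofAdd (1 : ℤ) else 1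
  let σb : FreeGroup (Fin 2) →* Multiplicative ℤ :=
    FreeGroup.lift fun j => if j = (1 : Fin 2) then Multiplicative.ofAdd (1 : ℤ) else 1
  have hσaa : σa a = Multiplicative.ofAdd 1 := by simp [σa, a]
  have hσab : σa b = 1 := by simp [σa, b]
  have hσba : σb a = 1 := by simp [σb, a]
  have hσbb : σb b = Multiplicative.ofAdd 1 := by simp [σb, b]
  -- their completions, and the completions of `k ↦ a^k`, `k ↦ b^k`
  let e : P →ₜ* Zh := (ProfiniteGrp.ProfiniteCompletion.lift (GrpCat.ofHom (ι.comp σa))).hom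
  let êb : P →ₜ* Zh := (ProfiniteGrp.ProfiniteCompletion.lift (GrpCat.ofHom (ι.comp σb))).hom
  let îa : Zh →ₜ* P :=
    (ProfiniteGrp.ProfiniteCompletion.lift (GrpCat.ofHom (η.comp (zpowersHom _ a)))).hom
  let îb : Zh →ₜ* P :=
    (ProfiniteGrp.ProfiniteCompletion.lift (GrpCat.ofHom (η.comp (zpowersHom _ b)))).hom
  have he : ∀ g, e (η g) = ι (σa g) := fun g => lift_hom_toCompletion Zh (ι.comp σa) g
  have hêb : ∀ g, êb (η g) = ι (σb g) := fun g => lift_hom_toCompletion Zh (ι.comp σb) g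
  have hîa : ∀ k : ℤ, îa (ι (Multiplicative.ofAdd k)) = η (a ^ k) := fun k => by
    rw [lift_hom_toCompletion P (η.comp (zpowersHom _ a))]
    simp [zpowersHom_apply]
  have hîb : ∀ k : ℤ, îb (ι (Multiplicative.ofAdd k)) = η (b ^ k) := fun k => by
    rw [lift_hom_toCompletion P (η.comp (zpowersHom _ b))]
    simp [zpowersHom_apply]
  have hιinj : Injective ι := toCompletion_int_injective
  -- the fibre product `Γ`
  let Γ : Subgroup (P × Multiplicative ℤ) :=
    (e.toMonoidHom.comp (MonoidHom.fst P (Multiplicative ℤ))).eqLocus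
      (ι.comp (MonoidHom.snd P (Multiplicative ℤ)))
  have hΓ : ∀ p : P × Multiplicative ℤ, p ∈ Γ ↔ e p.1 = ι p.2 := fun p => Iff.rfl
  -- hypotheses of parts A–C
  have hηd : DenseRange η := ProfiniteGrp.ProfiniteCompletion.denseRange (GrpCat.of (FreeGroup (Fin 2)))
  have hηN : ∀ N : Subgroup (FreeGroup (Fin 2)), N.Normal → N.FiniteIndex →
      ∃ V : OpenNormalSubgroup P, ∀ g, η g ∈ V ↔ g ∈ N :=
    fun N _ _ => exists_openNormal_eta_mem_iff N
  have hs : Surjective σa := fun n => ⟨a ^ n.toAdd, by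
    rw [map_zpow, hσaa, ← ofAdd_zsmul, smul_eq_mul, mul_one]; rfl⟩
  have hZ : ∀ A : Subgroup (Multiplicative ℤ), A.FiniteIndex →
      ∀ k : Multiplicative ℤ, ι k ∈ closure (ι '' (A : Set (Multiplicative ℤ))) → k ∈ A :=
    fun A hA k hk => by haveI := hA; exact mem_of_toCompletion_mem_closure A k hk
  -- the model group `Π := Γ` and its structure maps
  haveI hsc : SecondCountableTopology P := secondCountableTopology_profiniteCompletion_freeGroup (Fin 2)
  have hT : IsTempered Γ := TemperedFibreProduct.isTempered e ι Γ hΓ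
  have hSlim : IsSlimGroup Γ :=
    TemperedFibreProduct.isSlimGroup e êb îa îb σa σb hσaa hσab hσba hσbb he hêb hîa hîb hιinj Γ hΓ
  let aug : Γ →ₜ* Field.absoluteGaloisGroup K := 1
  have haug_ker : aug.toMonoidHom.ker = ⊤ := by
    ext x; simp [MonoidHom.mem_ker, Subsingleton.elim (aug x) 1]
  have hkerOpen : IsOpen (aug.toMonoidHom.ker : Set Γ) := by rw [haug_ker]; exact isOpen_univ
  have hkerClosed : IsClosed (aug.toMonoidHom.ker : Set Γ) := by rw [haug_ker]; exact isClosed_univ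
  let zQuot : Γ →* Multiplicative ℤ := (MonoidHom.snd P (Multiplicative ℤ)).comp Γ.subtype
  let toHat : Γ →ₜ* P := ⟨(MonoidHom.fst P (Multiplicative ℤ)).comp Γ.subtype,
    continuous_fst.comp continuous_subtype_val⟩
  have htoHat : ∀ q : Γ, toHat q = (q : P × Multiplicative ℤ).1 := fun _ => rfl
  have hPC : IsProfiniteCompletion toHat :=
    TemperedFibreProduct.isProfiniteCompletion_fst e ι Γ hΓ η hηd hηN σa hs he hZ toHat htoHat
  let augHat : P →ₜ* Field.absoluteGaloisGroup K := 1
  -- `Ker augHat = ⊤ =` the closure of the image of `Ker aug = ⊤` (density of `pr₁`)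
  have hclosure : ((aug.toMonoidHom.ker).map toHat.toMonoidHom).topologicalClosure = ⊤ := by
    rw [haug_ker, eq_top_iff]
    intro x _
    have hx : x ∈ closure (Set.range toHat) := by
      rw [hPC.denseRange.closure_range]; exact Set.mem_univ _
    have hsub : Set.range toHat ⊆ ((⊤ : Subgroup Γ).map toHat.toMonoidHom : Set P) := by
      rintro _ ⟨q, rfl⟩; exact ⟨q, Subgroup.mem_top q, rfl⟩
    exact closure_mono hsub hx
  have hkerHat : augHat.toMonoidHom.ker = ((aug.toMonoidHom.ker).map toHat.toMonoidHom).topologicalClosure := by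
    rw [hclosure]; ext x; simp [MonoidHom.mem_ker, Subsingleton.elim (augHat x) 1]
  -- `Δ̂ (= ⊤ = F̂₂)` is profinite free on two generators: transport along `F̂₂ ≃ₜ* ↥⊤'`
  have hfree : ∃ x : Fin 2 → ((aug.toMonoidHom.ker).map toHat.toMonoidHom).topologicalClosure,
      IsFreeProfiniteOn _ x := by
    have hmem : ∀ y : P, y ∈ ((aug.toMonoidHom.ker).map toHat.toMonoidHom).topologicalClosure :=
      fun y => by rw [hclosure]; exact Subgroup.mem_top y
    let eS : P ≃ₜ* ((aug.toMonoidHom.ker).map toHat.toMonoidHom).topologicalClosure :=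
      { toFun := fun y => ⟨y, hmem y⟩
        invFun := fun y => y.1
        left_inv := fun _ => rfl
        right_inv := fun _ => rfl
        map_mul' := fun _ _ => rfl
        continuous_toFun := continuous_id.subtype_mk _
        continuous_invFun := continuous_subtype_val }
    exact ⟨_, (isFreeProfiniteOn_profiniteCompletion_freeGroup (Fin 2)).of_continuousMulEquiv eS⟩
  refine ⟨{
    Pi := Γ
    isTempered := hT
    aug := aug
    aug_surjective := fun g => ⟨1, Subsingleton.elim _ _⟩
    isTempered_ker := hT.subgroup_of_isClosed _ hkerClosed
    isSlimGroup := hSlim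
    isSlimGroup_ker := isSlimGroup_subgroup_of_isOpen hSlim _ hkerOpen
    secondCountableTopology := TemperedFibreProduct.secondCountableTopology Γ
    zQuot := zQuot
    zQuot_surjective := TemperedFibreProduct.snd_surjective_of e ι Γ hΓ
      (TemperedFibreProduct.exists_apply_eq_iota e ι η σa hs he)
    isOpen_ker_zQuot := TemperedFibreProduct.isOpen_ker_snd Γ
    PiHat := P
    toHat := toHat
    isProfiniteCompletion_toHat := hPC
    toHat_injective := TemperedFibreProduct.fst_injective e ι Γ hΓ hιinj
    augHat := augHat
    augHat_comp_toHat := fun g => Subsingleton.elim _ _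
    ker_augHat := hkerHat
    deltaHat_free := hfree
    cuspDecomp := {⊥}
    cuspDecomp_nonempty := ⟨⊥, rfl⟩
    isClosed_of_mem_cuspDecomp := fun D hD => by
      rw [Set.mem_singleton_iff.mp hD, Subgroup.coe_bot]; exact isClosed_singleton
    le_ker_of_mem_cuspDecomp := fun D hD => by rw [Set.mem_singleton_iff.mp hD]; exact bot_le
    conj_mem_cuspDecomp := fun D hD g => by
      rw [Set.mem_singleton_iff.mp hD, Subgroup.map_bot]; rfl
    map_aug_eq_top_of_mem_cuspDecomp := fun D hD =>
      eq_top_iff.mpr fun x _ => by rw [Subsingleton.elim x 1]; exact Subgroup.one_mem _ }⟩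

end Literature.AnabelianGeometry.SemiGraphs

end
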